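import Mathlib
import Summits.ValiantsHypothesis.ValiantsHypothesis.Theorems.FifoMatchingNNLinearDegreeCofactorHardShedWordMeasure
import Summits.ValiantsHypothesis.ValiantsHypothesis.Theorems.FifoMatchingNNLinearDegreeCofactorHardShedWordParamsTight
import Summits.ValiantsHypothesis.ValiantsHypothesis.Theorems.FifoMatchingNNLinearDegreeCofactorHardShedWordHeartTight
import HarnessLib

/-!
# Crux `NNLinearDegreeCofactorHard` (stmt-ValiantsHypothesis-23918), line `internal_cofactor`, stub S2b (ii):
# μ* = shedWord — THE MEASURE for one window AT THE INTERFACE DENSITY `1/16` (`a = 28`)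

`ShedWordMeasure.pricing_large` (p1) prices the band measure for a window with `1012 · #R′ ≤ N + 4` (density constant
`a = 1024`) through `heart_popped` and `Params.rate_of_heart`.  This is its twin at the MINIMUM density the interface
`InternalCofactor.avoidingCounts_of_pricing a (ha : 28 ≤ a)` admits, `16 · #R′ ≤ N + 4` (from `(a − 12) · #R ≤ N + 4`, any `a ≥ 28`):
the same measure (fill `H = g¹²`, band `w = g¹¹`, `E = N − 2(#R′ + H + w)`, `g = root16 N ≥ 4096`), the same gate pricing
`card_resp_mul_le_of_gates`, but the free-mass dichotomy is p3's `heart_popped_tight` (deficit `N/6 − #R′ − (N−E)/2 − H − 2F₀ − 6w`,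
which is `≥ g¹⁶/48` here, `ParamsTight.deficit_tight_ge`) and the rate comes from `ParamsTight.rate_of_heart_tight`:

* `pricing_large_tight` — for `16 · #R′ ≤ N + 4`: `BB` nonempty, `fifo ∘ shedWord` maps `BB` into the `R′`-avoiding nest-free
  perfect matchings, `2^N ≤ 2 · #BB`, and `#(BB ∩ Resp S) · (4/3)^{g/32} ≤ 2^N` for every balanced `S`.

(The window-independent small case is `ShedWordMeasure.pricing_small`, unchanged.)  Honest framing: measure-side content of S2b
for μ* at density `1/16`; nothing here proves the crux or VP ≠ VNP (not proved).  No definitions. [folklore]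
-/

noncomputable section

-- Sub = Summit single-conjunct layout: the duplicated namespace component is mandated by the tree.
set_option linter.dupNamespace false

namespace Summit.ValiantsHypothesis.ValiantsHypothesis.Theorems.FifoMatching.NNLinearDegreeCofactorHard.ShedWord

open Finset Literature.Computability.AlgebraicComplexity
open Summit.ValiantsHypothesis.ValiantsHypothesis.Theorems.FifoMatching.NNMonotoneHard
open Summit.ValiantsHypothesis.ValiantsHypothesis.Theorems.FifoMatching.NNLinearDegreeCofactorHard.QueueHistory
open Summit.ValiantsHypothesis.ValiantsHypothesis.Theorems.FifoMatching.NNLinearDegreeCofactorHard.CondProbBits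

variable {N : ℕ} (R : Finset (Fin N))

/-- **The pricing of μ* above the threshold, at trace density `1/16`.**  For even `N` with `g = root16 N ≥ 4096`, a defect set
`R` with `16 · #R ≤ N + 4` and density `≤ 1/4` on every prefix and suffix, the band bit strings `BB` (fill `H = g¹²`, band `w = g¹¹`,
adaptive time `E = N − 2(#R + H + w)`) and `f = fifo ∘ shedWord` satisfy the four conjuncts of `hμ` with rate `g / 32`. [folklore] -/
theorem pricing_large_tight (hN : Even N) (hg : 4096 ≤ root16 N) (hRc : 16 * R.card ≤ N + 4)
    (hpre : ∀ t ≤ N, 4 * (R.filter fun j => j.val < t).card ≤ t)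
    (hsuf : ∀ t ≤ N, 4 * (R.filter fun j => N ≤ j.val + t).card ≤ t) :
    ∃ BB : Finset (Fin N → Bool), ∃ f : (Fin N → Bool) → (Fin N → Fin N),
      BB.Nonempty ∧ (∀ y ∈ BB, f y ∈ (nestFreeMatchings N).filter (fun M => ∀ j ∈ R, M j ∉ R)) ∧
      (2 : ℝ) ^ N ≤ 2 * BB.card ∧
      ∀ S : Finset (Fin N), N < 3 * S.card → 3 * S.card ≤ 2 * N →
        ((BB.filter fun y => ∀ i, i ∈ S ↔ f y i ∈ S).card : ℝ) * (4 / 3 : ℝ) ^ (root16 N / 32) ≤ 2 ^ N := by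
  classical
  -- arithmetic (all in terms of `root16 N`)
  have hfit := fit_sixteen (N := N) hg hRc
  have hfb := fill_gt_band (g := root16 N) (by omega)
  set E₀ := N - 2 * (R.card + root16 N ^ 12 + root16 N ^ 11) with hE₀
  have hHN : root16 N ^ 12 ≤ N := by omega
  have h2 : 2 * (R.card + root16 N ^ 12 + root16 N ^ 11) ≤ N := by omega
  have hHE : root16 N ^ 12 ≤ E₀ := by omega
  have hEN : E₀ ≤ N := by omega
  have hF₀l := freeCount_fill_ge R (root16 N ^ 12) hHN hpre
  have hF₀u := freeCount_fill_le R (root16 N ^ 12)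
  have hwF : root16 N ^ 11 < freeCount R 0 (root16 N ^ 12) := by omega
  have hw : root16 N ^ 11 ≤ freeCount R 0 (root16 N ^ 12) := hwF.le
  have hgood := hgood_of_suffix R E₀ hsuf
  have hpar : R.card + freeCount R 0 (root16 N ^ 12) + root16 N ^ 11 + defectCount R E₀ N ≤ freeCount R E₀ N :=
    hpar_of_suffix R (root16 N ^ 12) hsuf h2
  have hNpos : 0 < N := by
    have := root16_pow_le N
    have h1 : 1 ≤ root16 N ^ 16 := Nat.one_le_pow _ _ (by omega)
    omega
  -- the measure
  set BB := (univ : Finset (Fin N → Bool)).filter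
    fun y => ∀ s, root16 N ^ 12 ≤ s → s ≤ E₀ → |fairWalk R (root16 N ^ 12) E₀ y s| < ((root16 N ^ 11 : ℕ) : ℤ) with hBB
  have hbalBB : ∀ y ∈ BB, (closerSet (shedWord R (root16 N ^ 12) E₀ y)).card =
      (openerSet (shedWord R (root16 N ^ 12) E₀ y)).card := by
    intro y hy
    rw [hBB, mem_filter] at hy
    exact balanced_of_band R (root16 N ^ 12) E₀ y hN hHE hEN hgood hw hy.2 hpar
  let f : (Fin N → Bool) → (Fin N → Fin N) := fun y =>
    if h : (closerSet (shedWord R (root16 N ^ 12) E₀ y)).card = (openerSet (shedWord R (root16 N ^ 12) E₀ y)).card then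
      fifo (shedWord R (root16 N ^ 12) E₀ y) h else id
  have hf : ∀ y (hy : y ∈ BB), f y = fifo (shedWord R (root16 N ^ 12) E₀ y) (hbalBB y hy) := by
    intro y hy
    simp only [f, dif_pos (hbalBB y hy)]
  have hband := card_band_ge R (root16 N ^ 12) E₀ hNpos hEN (w := root16 N ^ 11) (band_poly hg)
  refine ⟨BB, f, ?_, ?_, ?_, ?_⟩
  · -- nonempty, from the band count
    rw [← card_pos]
    have h2N : (0 : ℝ) < (2 : ℝ) ^ N := by positivity
    have : (0 : ℝ) < BB.card := by rw [← hBB] at hband; linarith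
    exact_mod_cast this
  · -- support: `fifo ∘ shedWord` avoids `R × R`
    intro y hy
    rw [hf y hy]
    exact fifo_shedWord_mem R (root16 N ^ 12) E₀ y (hbalBB y hy)
  · -- the band count
    rw [← hBB] at hband; exact hband
  · -- pricing of the respecting band words
    intro S hS₁ hS₂
    set A := BB.filter fun y => ∀ i, i ∈ S ↔ f y i ∈ S with hA
    have hAsub : A ⊆ BB := filter_subset _ _
    have hbalA : ∀ y ∈ A, (closerSet (shedWord R (root16 N ^ 12) E₀ y)).card =
        (openerSet (shedWord R (root16 N ^ 12) E₀ y)).card :=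
      fun y hy => hbalBB y (hAsub hy)
    have hrespA : ∀ y (hy : y ∈ A), ∀ i, i ∈ S ↔ fifo (shedWord R (root16 N ^ 12) E₀ y) (hbalA y hy) i ∈ S := by
      intro y hy i
      have hy' := (mem_filter.1 hy).2 i
      rwa [hf y (hAsub hy)] at hy'
    have hbandA : ∀ y ∈ A, ∀ s, root16 N ^ 12 ≤ s → s ≤ E₀ →
        |fairWalk R (root16 N ^ 12) E₀ y s| < ((root16 N ^ 11 : ℕ) : ℤ) := by
      intro y hy
      have := hAsub hy
      rw [hBB, mem_filter] at this
      exact this.2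
    refine card_resp_mul_le_of_gates R (root16 N ^ 12) E₀ S hEN hwF A (root16 N / 32) hbandA hbalA hrespA ?_
    intro y hy
    -- the TIGHT heart and the TIGHT rate
    have hheart := heart_popped_tight R (root16 N ^ 12) E₀ y (hbalA y hy) hHE hEN hw (hbandA y hy) S hS₁ hS₂ (hrespA y hy)
    have htests := testsAll_le_card_isTest R (root16 N ^ 12) E₀ y S hEN hw (hbandA y hy)
    refine rate_of_heart_tight (N := N) (Rc := R.card) (F₀ := freeCount R 0 (root16 N ^ 12))
      (P := sBoundariesPopped R (root16 N ^ 12) E₀ y S)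
      (T := ((range N).filter fun j => isTest R (root16 N ^ 12) E₀ y S j = true).card) hg hRc hF₀l hF₀u ?_
    have hhalf : (N - E₀) / 2 = R.card + root16 N ^ 12 + root16 N ^ 11 := by omega
    rcases hheart with h | h
    · left
      rw [hhalf] at h
      exact h
    · right
      have e1 : 2 * root16 N ^ 11 * (2 * sBoundariesPopped R (root16 N ^ 12) E₀ y S + 1) =
          4 * root16 N ^ 11 * sBoundariesPopped R (root16 N ^ 12) E₀ y S + 2 * root16 N ^ 11 := by ring
      rw [e1] at h ⊢
      set X := root16 N ^ 11 * sBoundariesPopped R (root16 N ^ 12) E₀ y S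
      omega

end Summit.ValiantsHypothesis.ValiantsHypothesis.Theorems.FifoMatching.NNLinearDegreeCofactorHard.ShedWord

end
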